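import Summits.KontsevichZagierPeriods.KontsevichZagierPeriods.Theorems.RootDecompWalshStrataBall4Rung
import Literature.NumberTheory.Transcendental.KZUnfolding
import Literature.NumberTheory.Transcendental.KZMellinFibres

/-!
# The `d = 4` slice of the lever: general clauses (cube symmetries and cylinders)

Route `RootDecompWalshStrata` (cell decomp-kz, lens 4, gen 11), support toward `QuadricSignKernel`
(item stmt-KontsevichZagierPeriods-25393).  The node of this generation isolates the theorem-type
piece `QuadricTwoDescentFour = ∀ P, QuadricTwoDescentFourAt P` (every constant-weight quadric 4-cell
`[(0,1)⁴ ∩ {P > 0}, q]`, `deg P ≤ 2`, descends inside the three KZ rules to the `ℤ`-span of classes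
of KZ-rational representations of dimension `≤ 2`); four specimens (ball, paraboloid, split,
cone) are decided in the sibling files.  This file proves the first clauses valid for ALL `P`:

* `quadricTwoDescentFourAt_of_cellRep` — it suffices to treat the standard representation
  `cellRep P q` (any representation with the same domain and weight is equivalent to it, rule (1b));
* `quadricTwoDescentFourAt_rename` — invariance under the `24` coordinate permutations
  (`P ↦ rename σ P`; the move is the tree's `KZ.permRel ⊆ KZ.relations`, rule (2) with `|det| = 1`);
* `quadricTwoDescentFourAt_reflect` — invariance under the `16` face reflections `xⱼ ↦ 1 − xⱼ`
  (`P ↦ bind₁ (KZ.reflectSubst j) P`; the move is the tree's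
  `KZ.of_sub_of_mem_relations_of_boxReflection`), so each specimen decides the whole orbit of its
  quadric under the hyperoctahedral group of the cube (order `384`);
* `of_cellRep_rename_castSucc_sub_mem_relations` — the CYLINDER COLLAPSE in every dimension:
  `[(0,1)^{N+1} ∩ {g(x₀,…,x_{N−1}) > 0}, q] − [(0,1)^N ∩ {g > 0}, q] ∈ KZ.relations` (rule (3) along
  the last variable with the primitive `q·x_N`, rule (1a) to open the fibres);
* `quadricTwoDescentFourAt_cylinder` — hence every DEGENERATE quadric 4-cell whose polynomial
  omits a variable is decided by the PROVED `d ≤ 3` slice `QuadricBakerDescent` (item 27597):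
  `QuadricBakerDescent → QuadricTwoDescentFourAt (rename Fin.castSucc g)` for all `g` of degree `≤ 2`
  in three variables (and, by the permutation clause, for a variable omitted in any position).

0 sorry.  [KontsevichZagier2001 §1.2 rules (1)–(3)]
-/

noncomputable section

open Literature.NumberTheory.Transcendental
open MeasureTheory Set
open MvPolynomial (aeval X C rename bind₁)
open Literature.ModelTheory.ExponentialFields (IsSemialgebraic isSemialgebraic_setOf_eval_pos)
open Summit.KontsevichZagierPeriods.RootDecompWalshStrata.WalshSpanProof (isSemialgebraic_cubeSet
  isBounded_cubeSet cellRep cellRep_domain cellRep_integrand)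
open Summit.KontsevichZagierPeriods.RootDecompWalshStrata.QuadricFourRung (QuadricTwoDescentFourAt)
open Summit.KontsevichZagierPeriods.KontsevichZagierPeriods.Theses.RootDecompWalshStrata
  (QuadricBakerDescent)

namespace Summit.KontsevichZagierPeriods.RootDecompWalshStrata.FourSym

/-! #### Normalisation to the standard cell representation -/

/-- A representation whose domain is the cell `(0,1)^N ∩ {g > 0}` and whose weight is the constant
`q` on it is equivalent to `cellRep g q` (rule (1b): they differ by a zero integrand).
[KontsevichZagier2001 §1.2 rule (1)] -/
theorem of_sub_of_cellRep_mem_relations {N : ℕ} (g : MvPolynomial (Fin N) ℚ) (q : ℚ)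
    (ρ : KZ.IntegralRep N)
    (hρ : ρ.domain = {x | (∀ j, 0 < x j ∧ x j < 1) ∧ 0 < aeval x g} ∧
      ∀ x ∈ ρ.domain, ρ.integrand x = (q : ℝ)) :
    KZ.of ρ - KZ.of (cellRep g q) ∈ KZ.relations :=
  KZ.of_sub_of_mem_relations_of_eqOn (by rw [hρ.1, cellRep_domain]) fun x hx => by
    rw [hρ.2 x hx, cellRep_integrand]

/-- **Reduction to the standard representation:** to decide the slice of the lever at `P` it
suffices to descend `cellRep P q` for every rational weight `q`. [KontsevichZagier2001 §1.2] -/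
theorem quadricTwoDescentFourAt_of_cellRep {P : MvPolynomial (Fin 4) ℚ}
    (h : P.totalDegree ≤ 2 → ∀ q : ℚ, ∃ y ∈ AddSubgroup.closure
      {y : KZ.FormalRep | ∃ (m : ℕ) (N : KZ.IntegralRep m), m ≤ 2 ∧ N.IsRational ∧ y = KZ.of N},
      KZ.of (cellRep P q) - y ∈ KZ.relations) :
    QuadricTwoDescentFourAt P := by
  intro q ρ hρ hdeg
  obtain ⟨y, hy, hrel⟩ := h hdeg q
  refine ⟨y, hy, ?_⟩
  have : KZ.of ρ - y = (KZ.of ρ - KZ.of (cellRep P q)) + (KZ.of (cellRep P q) - y) := by abel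
  rw [this]
  exact add_mem (of_sub_of_cellRep_mem_relations P q ρ hρ) hrel

/-- Conversely the slice at `P` descends `cellRep P q`. [KontsevichZagier2001 §1.2] -/
theorem exists_descent_cellRep {P : MvPolynomial (Fin 4) ℚ} (h : QuadricTwoDescentFourAt P)
    (hdeg : P.totalDegree ≤ 2) (q : ℚ) :
    ∃ y ∈ AddSubgroup.closure
      {y : KZ.FormalRep | ∃ (m : ℕ) (N : KZ.IntegralRep m), m ≤ 2 ∧ N.IsRational ∧ y = KZ.of N},
      KZ.of (cellRep P q) - y ∈ KZ.relations :=
  h q (cellRep P q) ⟨cellRep_domain P q, fun x _ => cellRep_integrand P q x⟩ hdeg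

/-! #### Invariance under coordinate permutations -/

/-- Renaming back: `P = rename σ⁻¹ (rename σ P)`. [folklore] -/
theorem rename_symm_rename {N : ℕ} (σ : Equiv.Perm (Fin N)) (P : MvPolynomial (Fin N) ℚ) :
    rename σ.symm (rename σ P) = P := by
  rw [MvPolynomial.rename_rename, Equiv.symm_comp_self, MvPolynomial.rename_id, AlgHom.id_apply]

/-- `deg P ≤ deg (rename σ P)` for a permutation `σ` (equality in fact). [folklore] -/
theorem totalDegree_le_totalDegree_rename {N : ℕ} (σ : Equiv.Perm (Fin N))
    (P : MvPolynomial (Fin N) ℚ) : P.totalDegree ≤ (rename σ P).totalDegree := by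
  conv_lhs => rw [← rename_symm_rename σ P]
  exact MvPolynomial.totalDegree_rename_le _ _

/-- The reindexed standard representation of the renamed cell is a representation of the original
cell: `(cellRep (rename σ P) q).reindex σ⁻¹` has domain `(0,1)^N ∩ {P > 0}` and weight `q`.
[KontsevichZagier2001 §1.2 rule (2)] -/
theorem reindex_cellRep_rename {N : ℕ} (σ : Equiv.Perm (Fin N)) (P : MvPolynomial (Fin N) ℚ)
    (q : ℚ) :
    ((cellRep (rename σ P) q).reindex σ.symm).domain =
        {x | (∀ j, 0 < x j ∧ x j < 1) ∧ 0 < aeval x P} ∧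
      ∀ x ∈ ((cellRep (rename σ P) q).reindex σ.symm).domain,
        ((cellRep (rename σ P) q).reindex σ.symm).integrand x = (q : ℝ) := by
  refine ⟨?_, fun x _ => by simp [KZ.IntegralRep.reindex_integrand, cellRep_integrand]⟩
  ext x
  simp only [KZ.IntegralRep.reindex_domain, cellRep_domain, mem_setOf_eq, MvPolynomial.aeval_rename]
  have hc : (fun i => x (σ.symm i)) ∘ ⇑σ = x := by
    ext i
    simp
  rw [hc]
  exact and_congr_left fun _ => σ.symm.forall_congr_right (q := fun j => 0 < x j ∧ x j < 1)

/-- **Permutation invariance of the slice:** if the lever holds at `P` then it holds at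
`rename σ P` for every permutation `σ` of the four coordinates (the move `[r] − [r.reindex σ⁻¹]` is
an instance of rule (2) with `|det| = 1`, `KZ.permRel ⊆ KZ.relations`).
[KontsevichZagier2001 §1.2 rule (2)] -/
theorem quadricTwoDescentFourAt_rename {P : MvPolynomial (Fin 4) ℚ} (σ : Equiv.Perm (Fin 4))
    (h : QuadricTwoDescentFourAt P) : QuadricTwoDescentFourAt (rename σ P) := by
  refine quadricTwoDescentFourAt_of_cellRep fun hdeg' q => ?_
  have hdeg : P.totalDegree ≤ 2 := (totalDegree_le_totalDegree_rename σ P).trans hdeg'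
  set r := cellRep (rename σ P) q with hr
  obtain ⟨y, hy, hrel⟩ := h q (r.reindex σ.symm) (reindex_cellRep_rename σ P q) hdeg
  refine ⟨y, hy, ?_⟩
  have hperm : KZ.of r - KZ.of (r.reindex σ.symm) ∈ KZ.relations :=
    KZ.permRel_subset_relations (KZ.of_sub_of_reindex_mem_permRel r σ.symm)
  have : KZ.of r - y = (KZ.of r - KZ.of (r.reindex σ.symm)) + (KZ.of (r.reindex σ.symm) - y) := by
    abel
  rw [this]
  exact add_mem hperm hrel

/-! #### Invariance under the face reflections `xⱼ ↦ 1 − xⱼ` -/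

/-- The cube `(0,1)^N` is invariant under a box reflection. [folklore] -/
theorem cube_boxReflection_iff {N : ℕ} (j : Fin N) (x : Fin N → ℝ) :
    (∀ i, 0 < KZ.boxReflection j x i ∧ KZ.boxReflection j x i < 1) ↔ ∀ i, 0 < x i ∧ x i < 1 :=
  KZ.forall_boxReflection_mem_Ioo_iff

/-- The reflected cell is the preimage of the cell under the box reflection:
`(0,1)^N ∩ {P ∘ R_j > 0} = R_j ⁻¹' ((0,1)^N ∩ {P > 0})`. [KontsevichZagier2001 §1.2 rule (2)] -/
theorem cellRep_reflect_domain {N : ℕ} (j : Fin N) (P : MvPolynomial (Fin N) ℚ) (q : ℚ) :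
    (cellRep (bind₁ (KZ.reflectSubst j) P) q).domain =
      KZ.boxReflection j ⁻¹' (cellRep P q).domain := by
  ext x
  simp only [cellRep_domain, mem_setOf_eq, mem_preimage, MvPolynomial.aeval_bind₁,
    KZ.aeval_reflectSubst_eq, cube_boxReflection_iff]

/-- **Reflection invariance of the slice:** if the lever holds at `P` (`deg P ≤ 2`) then it holds at
the reflected quadric `P ∘ (xⱼ ↦ 1 − xⱼ) = bind₁ (KZ.reflectSubst j) P` (the move is rule (2) along
the affine involution `R_j`, `|det| = 1`: the tree's `KZ.of_sub_of_mem_relations_of_boxReflection`).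
With the permutation clause, one specimen decides the orbit of its quadric under the `384`
symmetries of the cube. [KontsevichZagier2001 §1.2 rule (2)] -/
theorem quadricTwoDescentFourAt_reflect {P : MvPolynomial (Fin 4) ℚ} (j : Fin 4)
    (hdeg : P.totalDegree ≤ 2) (h : QuadricTwoDescentFourAt P) :
    QuadricTwoDescentFourAt (bind₁ (KZ.reflectSubst j) P) := by
  refine quadricTwoDescentFourAt_of_cellRep fun _ q => ?_
  obtain ⟨y, hy, hrel⟩ := exists_descent_cellRep h hdeg q
  refine ⟨y, hy, ?_⟩
  have hrefl : KZ.of (cellRep (bind₁ (KZ.reflectSubst j) P) q) - KZ.of (cellRep P q) ∈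
      KZ.relations :=
    KZ.of_sub_of_mem_relations_of_boxReflection j (cellRep_reflect_domain j P q) fun x _ => by
      rw [cellRep_integrand, cellRep_integrand]
  have : KZ.of (cellRep (bind₁ (KZ.reflectSubst j) P) q) - y =
      (KZ.of (cellRep (bind₁ (KZ.reflectSubst j) P) q) - KZ.of (cellRep P q)) +
        (KZ.of (cellRep P q) - y) := by abel
  rw [this]
  exact add_mem hrefl hrel

/-! #### The cylinder collapse `[cell(g) × (0,1), q] ≡ [cell(g), q]` -/

/-- Membership in the cylinder cell: `x ∈ (0,1)^{N+1} ∩ {g(x₀,…,x_{N−1}) > 0}` iff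
`init x ∈ (0,1)^N ∩ {g > 0}` and `0 < x_N < 1`. [definition] -/
theorem mem_cylCell_iff_init {N : ℕ} (g : MvPolynomial (Fin N) ℚ) (q : ℚ) (x : Fin (N + 1) → ℝ) :
    x ∈ (cellRep (rename Fin.castSucc g) q).domain ↔
      Fin.init x ∈ (cellRep g q).domain ∧ 0 < x (Fin.last N) ∧ x (Fin.last N) < 1 := by
  simp only [cellRep_domain, mem_setOf_eq, MvPolynomial.aeval_rename, Fin.forall_fin_succ']
  constructor
  · rintro ⟨⟨hc, hl⟩, hg⟩
    exact ⟨⟨hc, hg⟩, hl⟩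
  · rintro ⟨⟨hc, hg⟩, hl⟩
    exact ⟨⟨hc, hl⟩, hg⟩

/-- The closed band `cell(g) × [0,1]` lies in the unit box. [folklore] -/
theorem band_cell_subset_Icc {N : ℕ} (g : MvPolynomial (Fin N) ℚ) (q : ℚ) :
    KZlog.band (cellRep g q).domain (fun _ => (0:ℝ)) (fun _ => (1:ℝ)) ⊆ Icc 0 1 := by
  intro x hx
  rw [KZlog.mem_band] at hx
  obtain ⟨hu, h0, h1⟩ := hx
  rw [cellRep_domain] at hu
  have hu' := hu.1
  refine ⟨fun i => ?_, fun i => ?_⟩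
  · refine Fin.lastCases ?_ (fun i => ?_) i
    · simpa using h0
    · exact (hu' i).1.le
  · refine Fin.lastCases ?_ (fun i => ?_) i
    · simpa using h1
    · exact (hu' i).2.le

/-- **The cylinder collapse (moves (3) + (1a)):** Newton–Leibniz along the last variable with the
primitive `q·x_N` over the cell of `g` (fibres `[0, 1]`), then opening the fibres:
`[(0,1)^{N+1} ∩ {g(x₀,…,x_{N−1}) > 0}, q] − [(0,1)^N ∩ {g > 0}, q] ∈ KZ.relations` (`N + 1 → N`).
[KontsevichZagier2001 §1.2 rules (1), (3)] -/
theorem of_cellRep_rename_castSucc_sub_mem_relations {N : ℕ} (g : MvPolynomial (Fin N) ℚ)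
    (q : ℚ) :
    KZ.of (cellRep (rename Fin.castSucc g) q) - KZ.of (cellRep g q) ∈ KZ.relations := by
  have hBs : IsSemialgebraic ℚ (cellRep g q).domain := (cellRep g q).isSemialgebraic_domain
  have ha : IsSemialgebraicFunOn ℚ (cellRep g q).domain (fun _ => (0:ℝ)) := by
    simpa using isSemialgebraicFunOn_ratCast hBs 0
  have hb : IsSemialgebraicFunOn ℚ (cellRep g q).domain (fun _ => (1:ℝ)) := by
    simpa using isSemialgebraicFunOn_ratCast hBs 1
  have hab : ∀ u ∈ (cellRep g q).domain, (fun _ => (0:ℝ)) u ≤ (fun _ => (1:ℝ)) u :=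
    fun u _ => zero_le_one
  have hband : IsSemialgebraic ℚ (KZlog.band (cellRep g q).domain (fun _ => (0:ℝ)) fun _ => (1:ℝ)) :=
    KZlog.isSemialgebraic_band ha hb
  have hbdry : ∀ u ∈ (cellRep g q).domain,
      (q : ℝ) * (Fin.snoc u ((fun _ => (1:ℝ)) u) : Fin (N + 1) → ℝ) (Fin.last N) -
        (q : ℝ) * (Fin.snoc u ((fun _ => (0:ℝ)) u) : Fin (N + 1) → ℝ) (Fin.last N) =
          (cellRep g q).integrand u := by
    intro u _
    simp only [Fin.snoc_last, cellRep_integrand]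
    ring
  obtain ⟨rb, rd, hrbd, hrbi, hrdd, hrdi, hrel⟩ := KZ.exists_band_newtonLeibniz hBs
    (fun _ => (0:ℝ)) (fun _ => (1:ℝ)) ha hb hab
    (fun x => (q : ℝ) * x (Fin.last N)) (fun _ => (q : ℝ))
    ((isSemialgebraicFunOn_aeval hband (C q * X (Fin.last N))).congr fun x _ => by simp)
    (by simpa using isSemialgebraicFunOn_ratCast hband q)
    (fun u _ => by
      simp only [Fin.snoc_last]
      exact (continuous_const.mul continuous_id).continuousOn)
    (fun u _ s _ => by
      simp only [Fin.snoc_last]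
      exact ((hasDerivAt_id s).const_mul (q : ℝ)).congr_deriv (mul_one _))
    ((continuous_const.continuousOn.integrableOn_compact isCompact_Icc).mono_set
      (band_cell_subset_Icc g q))
    ((cellRep g q).isSemialgebraicFunOn_integrand.congr fun u hu => (hbdry u hu).symm)
    (((cellRep g q).integrableOn.congr_fun (fun u hu => (hbdry u hu).symm)
      hBs.measurableSet_holds))
  obtain ⟨rb', hrb'd, hrb'i, hrel'⟩ := KZ.of_sub_of_restrict_openBand_mem_relations ha hb rb hrbd
  have hpin1 : KZ.of rb' - KZ.of (cellRep (rename Fin.castSucc g) q) ∈ KZ.relations := by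
    refine KZ.of_sub_of_mem_relations_of_eqOn ?_ fun x _ => ?_
    · rw [hrb'd]
      ext x
      exact mem_cylCell_iff_init g q x
    · rw [hrb'i, hrbi, cellRep_integrand]
  have hpin2 : KZ.of rd - KZ.of (cellRep g q) ∈ KZ.relations := by
    refine KZ.of_sub_of_mem_relations_of_eqOn ?_ fun u hu => ?_
    · rw [hrdd]
    · rw [hrdi]
      rw [hrdd] at hu
      exact hbdry u hu
  have : KZ.of (cellRep (rename Fin.castSucc g) q) - KZ.of (cellRep g q) =
      (KZ.of rb - KZ.of rd) - (KZ.of rb - KZ.of rb') -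
        (KZ.of rb' - KZ.of (cellRep (rename Fin.castSucc g) q)) + (KZ.of rd - KZ.of (cellRep g q)) := by
    abel
  rw [this]
  exact add_mem (sub_mem (sub_mem hrel hrel') hpin1) hpin2

/-! #### Degenerate quadrics: the cylinders over `d = 3` cells are decided by item 27597 -/

/-- **Cylinders are decided by the `d ≤ 3` slice:** for every `g` of degree `≤ 2` in three
variables, the (PROVED) item `QuadricBakerDescent` (27597) gives the slice of the lever at the
cylinder quadric `rename Fin.castSucc g` (the 4-cell `cell(g) × (0,1)`): collapse the cylinder, then
descend `[cell(g), q]` to dimension `≤ 1 ⊆ ≤ 2`. [KontsevichZagier2001 §1.2; this node] -/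
theorem quadricTwoDescentFourAt_cylinder (hB : QuadricBakerDescent) (g : MvPolynomial (Fin 3) ℚ)
    (hg : g.totalDegree ≤ 2) : QuadricTwoDescentFourAt (rename Fin.castSucc g) := by
  refine quadricTwoDescentFourAt_of_cellRep fun _ q => ?_
  obtain ⟨y, hy, hrel⟩ :=
    hB 3 g q (cellRep g q) ⟨cellRep_domain g q, fun x _ => cellRep_integrand g q x⟩ hg le_rfl
  refine ⟨y, AddSubgroup.closure_mono ?_ hy, ?_⟩
  · rintro _ ⟨m, N, hm, hN, rfl⟩
    exact ⟨m, N, hm.trans (by norm_num), hN, rfl⟩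
  · have : KZ.of (cellRep (rename Fin.castSucc g) q) - y =
        (KZ.of (cellRep (rename Fin.castSucc g) q) - KZ.of (cellRep g q)) +
          (KZ.of (cellRep g q) - y) := by abel
    rw [this]
    exact add_mem (of_cellRep_rename_castSucc_sub_mem_relations g q) hrel

/-- **A variable omitted in any position:** combining the cylinder clause with permutation
invariance, `QuadricBakerDescent` decides the slice at `rename σ (rename Fin.castSucc g)` for every
permutation `σ` of the four coordinates. [KontsevichZagier2001 §1.2; this node] -/
theorem quadricTwoDescentFourAt_cylinder_rename (hB : QuadricBakerDescent)
    (g : MvPolynomial (Fin 3) ℚ) (hg : g.totalDegree ≤ 2) (σ : Equiv.Perm (Fin 4)) :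
    QuadricTwoDescentFourAt (rename σ (rename Fin.castSucc g)) :=
  quadricTwoDescentFourAt_rename σ (quadricTwoDescentFourAt_cylinder hB g hg)

end Summit.KontsevichZagierPeriods.RootDecompWalshStrata.FourSym

end
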